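import Literature.MathematicalPhysics.QuantumFieldTheory.ConformalBootstrap3D.PointKernelK34L505Data
import Literature.MathematicalPhysics.QuantumFieldTheory.ConformalBootstrap3D.PointKernelK34L505Segs
import Literature.MathematicalPhysics.QuantumFieldTheory.ConformalBootstrap3D.PointKernelParts

/-!
# K34L505 certificate, kernel part file P55: one-cell head segments 121, 122 in level ranges

The head cells whose kernel evaluation exceeds one `decide` are one-cell segments of `hsegsK34L505`; each is
checked by `PCert.hPartSideOK` (side conditions) and `PCert.hPartOK` per level range `[n_lo, n_lo + count)`
against an integer claim, the claims summing to `≥ 0` (`PointKernel.partsOK`); soundness is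
`PCert.hParts_sound` (`PointKernelParts`).  The part files are mutually independent (each imports only
the data file); the ranges of one cell may span several of them, and the per-cell conclusions
`hparts_i` / `hcell_i` of those cells are assembled in `PointKernelK34L505.lean`.
Estimated kernel time 255 s.
-/

set_option maxRecDepth 100000
set_option maxHeartbeats 0

namespace Literature.MathematicalPhysics.QuantumFieldTheory.ConformalBootstrap3D.PointKernelK34L505

open Literature.MathematicalPhysics.QuantumFieldTheory.ConformalBootstrap3D.PointKernel

/-- levels `[0, 32)` of segment 121: partial lower sum `≥` claim. [folklore] -/
theorem part_121_0 : certK34L505.hPartOK (PCert.segAt hsegsK34L505 121) JHK34L505 0 32 (-6089849019643716574621905872058241697) = true := by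
  decide +kernel

/-- levels `[32, 41)` of segment 121: partial lower sum `≥` claim. [folklore] -/
theorem part_121_1 : certK34L505.hPartOK (PCert.segAt hsegsK34L505 121) JHK34L505 32 9 (6089849019643716574621905872058241697) = true := by
  decide +kernel

/-- one-cell segment 122 (row 6, cell `[113/16, 453/64]`, chord, `n_F = 48`,
3 level ranges): side conditions. [folklore] -/
theorem pside_122 : certK34L505.hPartSideOK (PCert.segAt hsegsK34L505 122) JHK34L505 = true := by
  decide +kernel

/-- its level ranges `(n_lo, count, claim)`. [folklore] -/
def partsK34L505_122 : List (ℕ × ℕ × ℤ) := [(0, 31, -9196945299752133056388961623211094339), (31, 13, 8455202342122608051665356606144695176), (44, 5, 741742957629525004723605017066399164)]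

/-- the ranges tile `[0, n_F]` and the claims sum to `≥ 0`. [folklore] -/
theorem pcov_122 : PointKernel.partsOK 48 partsK34L505_122 = true := by
  decide +kernel

/-- levels `[0, 31)` of segment 122: partial lower sum `≥` claim. [folklore] -/
theorem part_122_0 : certK34L505.hPartOK (PCert.segAt hsegsK34L505 122) JHK34L505 0 31 (-9196945299752133056388961623211094339) = true := by
  decide +kernel

/-- levels `[31, 44)` of segment 122: partial lower sum `≥` claim. [folklore] -/
theorem part_122_1 : certK34L505.hPartOK (PCert.segAt hsegsK34L505 122) JHK34L505 31 13 (8455202342122608051665356606144695176) = true := by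
  decide +kernel

/-- levels `[44, 49)` of segment 122: partial lower sum `≥` claim. [folklore] -/
theorem part_122_2 : certK34L505.hPartOK (PCert.segAt hsegsK34L505 122) JHK34L505 44 5 (741742957629525004723605017066399164) = true := by
  decide +kernel

end Literature.MathematicalPhysics.QuantumFieldTheory.ConformalBootstrap3D.PointKernelK34L505
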